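import Summits.KontsevichZagierPeriods.KontsevichZagierPeriods.Theorems.FermatIsogenyBetaLinearSectorHalfIntegers
import Summits.KontsevichZagierPeriods.KontsevichZagierPeriods.Theorems.FermatIsogenyBetaLinearSectorTranslationClass
import Literature.NumberTheory.Transcendental.KZCalculus
import HarnessLib

/-!
# `BetaLinearSector` (stmt-KontsevichZagierPeriods-3897), line `fermat-sector-transport` — stub
# `stub_pinnedReflect` (PR: the two-sided, constant-carrying Fermat reflection)

Crux `BetaLinearSector` (route FermatIsogeny): two one-dimensional Kontsevich–Zagier representations pinned on
`(0,1)` as `[c·x^{a-1}(1-x)^{b-1}]` with equal values are KZ-equivalent.  The ONE-SIDED Fermat reflection rung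
(constant `1` on the left cell, `c` on the right cell, exponents `(a, b)` and `(a′, b′)` with `a + b + a′ = 1`,
`b′ = b`; on periods `B(a,b) = [sin π(a+b)/sin πa]·B(1−a−b, b)`) is taken here as a HYPOTHESIS, and turned into its
TWO-SIDED form with constants on both cells, `P⟦a, b, 1−a−b, b⟧` for `a + b < 1`:

* degenerate constant `c = 0`: the value `c·B(a,b)` vanishes, so `c′·B(1−a−b, b) = 0` with `B > 0`, hence `c′ = 0`,
  and both integrands vanish on their domains — two zero representations (rule 1);
* `c ≠ 0`: pin auxiliary representations `T = [x^{a-1}(1-x)^{b-1}]` and `T″ = [(c′/c)·x^{-a-b}(1-x)^{b-1}]`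
  (`exists_pinned`); their values agree (`value_of_pinned`), the one-sided rung gives `T ∼ T″`, scaling by the
  algebraic constant `c` (`Equivalent.constMul`) gives `c·T ∼ c·T″`, and the congruences `r ∼ c·T`, `r′ ∼ c·T″`
  (`equivalent_constMul_of_pinned`) conclude — pure bookkeeping in the KZ calculus, exactly as `pinned_swap`.

References: M. Kontsevich, D. Zagier, *Periods* (2001), §1.2; G. E. Andrews, R. Askey, R. Roy, *Special Functions*
(1999), Thm 1.1.4.
-/

noncomputable section

open MeasureTheory Set
open Literature.NumberTheory.Transcendental
open Literature.NumberTheory.Transcendental.KZ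
open Summit.KontsevichZagierPeriods.FermatIsogeny.BetaLinearSector.HalfIntegers

namespace Summit.KontsevichZagierPeriods.FermatIsogeny.BetaLinearSector

namespace PinnedReflect

/-- Positivity of the Beta quotient `Γ(p)Γ(q)/Γ(p+q)` for positive rational `p, q`.
[cite: AndrewsAskeyRoy1999, Thm 1.1.4] -/
theorem betaQuot_pos {p q : ℚ} (hp : 0 < p) (hq : 0 < q) :
    0 < Real.Gamma (p:ℝ) * Real.Gamma (q:ℝ) / Real.Gamma ((p:ℝ) + (q:ℝ)) := by
  have hpR : (0:ℝ) < p := by exact_mod_cast hp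
  have hqR : (0:ℝ) < q := by exact_mod_cast hq
  exact div_pos (mul_pos (Real.Gamma_pos_of_pos hpR) (Real.Gamma_pos_of_pos hqR))
    (Real.Gamma_pos_of_pos (by linarith))

/-- DEGENERATE CONSTANTS: two representations pinned with the constant `0` (any exponents) are KZ-equivalent — both
integrands vanish on their domains, so both classes are relations (rule 1). [cite: KontsevichZagier2001, §1.2 rule (1)] -/
theorem equivalent_of_pinned_zero {a b a' b' : ℚ} {r r' : IntegralRep 1}
    (hr : r.domain = {x | x 0 ∈ Set.Ioo (0:ℝ) 1} ∧
      Set.EqOn r.integrand (fun x => (0:ℝ) * (x 0) ^ ((a:ℝ) - 1) * (1 - x 0) ^ ((b:ℝ) - 1)) r.domain)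
    (hr' : r'.domain = {x | x 0 ∈ Set.Ioo (0:ℝ) 1} ∧
      Set.EqOn r'.integrand (fun x => (0:ℝ) * (x 0) ^ ((a':ℝ) - 1) * (1 - x 0) ^ ((b':ℝ) - 1)) r'.domain) :
    Equivalent r r' := by
  have h1 : of r ∈ relations := of_mem_relations_of_eqOn_zero r fun x hx => by
    rw [hr.2 hx]
    simp
  have h2 : of r' ∈ relations := of_mem_relations_of_eqOn_zero r' fun x hx => by
    rw [hr'.2 hx]
    simp
  exact relations.sub_mem h1 h2

end PinnedReflect

open PinnedReflect

/-- SECTOR STUB PR (two-sided reflection with constants, implication-shaped): the one-sided reflection rung (the statement of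
`stub_fermatReflectionRung`) implies its two-sided form — for positive rationals `a, b` with `a + b < 1` and real algebraic `c, c′`,
two representations pinned as `[c·x^{a−1}(1−x)^{b−1}]`, `[c′·x^{−a−b}(1−x)^{b−1}]` on `(0,1)` with equal values are KZ-equivalent
(`c = 0` degenerate: both integrands vanish; else scale the one-sided rung for the cells with constants `1`, `c′/c` by `c`:
`exists_pinned`, `equivalent_constMul_of_pinned`, `Equivalent.constMul`, `value_of_pinned`). [cite: KontsevichZagier2001, §1.2] -/
theorem stub_pinnedReflect :
    (∀ (a b a' b' : ℚ) (c : ℝ), 0 < a → 0 < b → 0 < a' → 0 < b' → IsAlgebraic ℚ c → a + b + a' = 1 → b' = b →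
      ∀ (r r' : KZ.IntegralRep 1),
        r.domain = {x | x 0 ∈ Set.Ioo (0:ℝ) 1} →
        Set.EqOn r.integrand (fun x => (x 0) ^ ((a:ℝ) - 1) * (1 - x 0) ^ ((b:ℝ) - 1)) r.domain →
        r'.domain = {x | x 0 ∈ Set.Ioo (0:ℝ) 1} →
        Set.EqOn r'.integrand (fun x => c * (x 0) ^ ((a':ℝ) - 1) * (1 - x 0) ^ ((b':ℝ) - 1)) r'.domain →
        r.value = r'.value → KZ.Equivalent r r') →
    ∀ (a b : ℚ), 0 < a → 0 < b → a + b < 1 → ∀ (c c' : ℝ) (r r' : KZ.IntegralRep 1),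
    IsAlgebraic ℚ c → IsAlgebraic ℚ c' →
    (r.domain = {x | x 0 ∈ Set.Ioo (0:ℝ) 1} ∧
      Set.EqOn r.integrand (fun x => c * (x 0) ^ ((a:ℝ) - 1) * (1 - x 0) ^ ((b:ℝ) - 1)) r.domain) →
    (r'.domain = {x | x 0 ∈ Set.Ioo (0:ℝ) 1} ∧
      Set.EqOn r'.integrand (fun x => c' * (x 0) ^ (((1 - a - b : ℚ) : ℝ) - 1) * (1 - x 0) ^ ((b:ℝ) - 1)) r'.domain) →
    r.value = r'.value → KZ.Equivalent r r' := by
  intro H a b ha hb hab c c' r r' hc hc' hr hr' hv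
  have ht : (0:ℚ) < 1 - a - b := by linarith
  -- the values of the two pinned representations
  have hvr : r.value = c * (Real.Gamma (a:ℝ) * Real.Gamma (b:ℝ) / Real.Gamma ((a:ℝ) + (b:ℝ))) :=
    value_of_pinned hr ha hb
  have hvr' : r'.value = c' * (Real.Gamma (((1 - a - b : ℚ)) : ℝ) * Real.Gamma (b:ℝ) /
      Real.Gamma ((((1 - a - b : ℚ)) : ℝ) + (b:ℝ))) :=
    value_of_pinned hr' ht hb
  have hB := betaQuot_pos ha hb
  have hB' := betaQuot_pos ht hb
  have key : c * (Real.Gamma (a:ℝ) * Real.Gamma (b:ℝ) / Real.Gamma ((a:ℝ) + (b:ℝ))) =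
      c' * (Real.Gamma (((1 - a - b : ℚ)) : ℝ) * Real.Gamma (b:ℝ) / Real.Gamma ((((1 - a - b : ℚ)) : ℝ) + (b:ℝ))) := by
    rw [← hvr, ← hvr']
    exact hv
  by_cases hc0 : c = 0
  · -- degenerate constants: `c = 0` forces `c' = 0`
    have hc'0 : c' = 0 := by
      have h0 : c' * (Real.Gamma (((1 - a - b : ℚ)) : ℝ) * Real.Gamma (b:ℝ) /
          Real.Gamma ((((1 - a - b : ℚ)) : ℝ) + (b:ℝ))) = 0 := by
        rw [← key, hc0, zero_mul]
      exact (mul_eq_zero.1 h0).resolve_right hB'.ne'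
    subst hc0 hc'0
    exact equivalent_of_pinned_zero hr hr'
  · -- non-degenerate: scale the one-sided rung for the constants `1`, `c'/c` by `c`
    have hk : IsAlgebraic ℚ (c' * c⁻¹) := hc'.mul hc.inv
    obtain ⟨T, hT⟩ := exists_pinned 1 isAlgebraic_one ha hb
    obtain ⟨T'', hT''⟩ := exists_pinned (c' * c⁻¹) hk ht hb
    have hvT : T.value = T''.value := by
      rw [value_of_pinned hT ha hb, value_of_pinned hT'' ht hb, one_mul, mul_comm c' c⁻¹, mul_assoc, ← key,
        ← mul_assoc, inv_mul_cancel₀ hc0, one_mul]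
    have h : Equivalent T T'' :=
      H a b (1 - a - b) b (c' * c⁻¹) ha hb ht hb hk (by ring) rfl T T'' hT.1
        (fun x hx => by simp only [hT.2 hx, one_mul]) hT''.1 hT''.2 hvT
    have e₁ : Equivalent r (T.constMul c hc) := equivalent_constMul_of_pinned hc hr hT (mul_one c).symm
    have e₂ : Equivalent r' (T''.constMul c hc) :=
      equivalent_constMul_of_pinned hc hr' hT'' (by rw [mul_comm c' c⁻¹, ← mul_assoc, mul_inv_cancel₀ hc0, one_mul])
    exact e₁.trans ((h.constMul c hc).trans e₂.symm)

end Summit.KontsevichZagierPeriods.FermatIsogeny.BetaLinearSector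

end
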